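import Mathlib

/-!
# A Bernstein inequality for randomly permuted sums, I: the exponential-moment recursion

For an array `a : Fin n → Fin n → ℝ` with `|a i j| ≤ m` and the permuted sum `Z(π) = Σ_i a i (π i)`, `π` uniform
on `S_n`, we prove the exponential-moment bound
`Σ_π exp(λ(Z(π) - μ)) ≤ n!·exp(λ²·B(a))`, `μ = n⁻¹Σ_{ij} a i j`, `0 ≤ λ ≤ 1/(4m)`,
with the ORDER-DEPENDENT variance budget `B(a) = Σ_k (4/(n-k) - 2/n)·‖a_k‖²` (`‖a_k‖² = Σ_j a k j²`), by the
martingale method (reveal `π(0), π(1), …`; the budget is an exact invariant of the one-step recursion):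
`mgf_perm_le`. Part II (`…PolynomialSlackPermBernstein`) sorts the rows (`B ≤ 8 H_n · n⁻¹Σa²`) and deduces
the counting tail bound `#{π : t ≤ |Z(π) - μ|} ≤ 2·n!·exp(-t²/(32(1 + log n)·n⁻¹Σ a² + 8mt))`, a crude-constant,
extra-`log n` version of the Bercu–Delyon–Rio inequality
(`Literature.Probability.Moments.BercuDelyonRio2015_permutedSum`), sufficient to make the level-one programme
on TPP triples in `S_n` unconditional.
-/

namespace Summit.MatrixMultiplication.MatrixMultiplication.Theorems.PolynomialSlack

open scoped BigOperators

-- `Summit.<Summit>.<Problem>` is the tree's mandated summit-side namespace (CONVENTIONS §2); for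
-- this single-conjunct summit the two coincide, so each declaration silences `dupNamespace`.
set_option linter.dupNamespace false

/-- **One step of the martingale method.** If `Σ_p d p = 0` and `|λ·d p| ≤ 1` for all `p` in a finite
index type of size `r`, then `Σ_p exp(λ d p) ≤ r·exp(λ²·Σ_p d p²/r)` (from `eˣ ≤ 1 + x + x²` on `|x| ≤ 1`
and `1 + y ≤ eʸ`). [folklore] -/
theorem sum_exp_le_card_mul_exp {ι : Type*} [Fintype ι] (d : ι → ℝ) (l : ℝ)
    (hsum : ∑ p, d p = 0) (hbd : ∀ p, |l * d p| ≤ 1) :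
    ∑ p, Real.exp (l * d p) ≤ Fintype.card ι * Real.exp (l ^ 2 * (∑ p, d p ^ 2) / Fintype.card ι) := by
  have h1 : ∀ p, Real.exp (l * d p) ≤ 1 + (l * d p + l ^ 2 * d p ^ 2) := fun p => by
    have := Real.abs_exp_sub_one_sub_id_le (hbd p)
    rw [abs_le] at this
    nlinarith [this.2]
  have h2 : ∑ p, Real.exp (l * d p) ≤ Fintype.card ι + l ^ 2 * ∑ p, d p ^ 2 := by
    calc ∑ p, Real.exp (l * d p) ≤ ∑ p, (1 + (l * d p + l ^ 2 * d p ^ 2)) :=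
          Finset.sum_le_sum fun p _ => h1 p
      _ = Fintype.card ι + (l * ∑ p, d p + l ^ 2 * ∑ p, d p ^ 2) := by
          rw [Finset.sum_add_distrib, Finset.sum_add_distrib, Finset.sum_const, Finset.card_univ,
            nsmul_eq_mul, mul_one, Finset.mul_sum, Finset.mul_sum]
      _ = Fintype.card ι + l ^ 2 * ∑ p, d p ^ 2 := by rw [hsum, mul_zero, zero_add]
  rcases (Fintype.card ι).eq_zero_or_pos with h0 | hpos
  · haveI : IsEmpty ι := Fintype.card_eq_zero_iff.mp h0
    simp
  have hr : (0 : ℝ) < Fintype.card ι := by exact_mod_cast hpos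
  calc ∑ p, Real.exp (l * d p) ≤ Fintype.card ι + l ^ 2 * ∑ p, d p ^ 2 := h2
    _ = Fintype.card ι * (l ^ 2 * (∑ p, d p ^ 2) / Fintype.card ι + 1) := by field_simp; ring
    _ ≤ Fintype.card ι * Real.exp (l ^ 2 * (∑ p, d p ^ 2) / Fintype.card ι) :=
        mul_le_mul_of_nonneg_left (Real.add_one_le_exp _) hr.le

/-- `Σ_{j < n} g(swap 0 p (j+1)) = Σ_{j ≤ n} g j - g p` in `Fin (n+1)`: the map `j ↦ swap 0 p (j+1)` is a
bijection from `Fin n` onto the complement of `p`. [folklore] -/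
theorem sum_swap_succ {n : ℕ} (p : Fin (n + 1)) (g : Fin (n + 1) → ℝ) :
    ∑ j : Fin n, g (Equiv.swap 0 p j.succ) = ∑ j, g j - g p := by
  have h := Equiv.sum_comp (Equiv.swap (0 : Fin (n + 1)) p) g
  rw [Fin.sum_univ_succ, Equiv.swap_apply_left] at h
  linarith

/-- Centering at the mean does not increase the sum of squares: `Σ_p (a p - (Σ a)/r)² ≤ Σ_p a p²`.
[folklore] -/
theorem sum_sq_sub_avg_le {ι : Type*} [Fintype ι] (a : ι → ℝ) :
    ∑ p, (a p - (∑ q, a q) / Fintype.card ι) ^ 2 ≤ ∑ p, a p ^ 2 := by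
  rcases (Fintype.card ι).eq_zero_or_pos with h0 | hpos
  · haveI : IsEmpty ι := Fintype.card_eq_zero_iff.mp h0
    simp
  have hr : (0 : ℝ) < Fintype.card ι := by exact_mod_cast hpos
  set c : ℝ := (∑ q, a q) / Fintype.card ι with hc
  have hcS : c * Fintype.card ι = ∑ q, a q := by rw [hc]; field_simp
  have e : ∑ p, (a p - c) ^ 2 = ∑ p, a p ^ 2 - 2 * c * ∑ p, a p + Fintype.card ι * c ^ 2 := by
    have : ∀ p, (a p - c) ^ 2 = a p ^ 2 - 2 * c * a p + c ^ 2 := fun p => by ring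
    simp_rw [this]
    rw [Finset.sum_add_distrib, Finset.sum_sub_distrib, Finset.sum_const, Finset.card_univ, nsmul_eq_mul,
      Finset.mul_sum]
  have h3 : 2 * c * ∑ p, a p = 2 * Fintype.card ι * c ^ 2 := by rw [← hcS]; ring
  rw [e, h3]
  nlinarith [mul_nonneg hr.le (sq_nonneg c)]

/-- **The martingale recursion** (`n ≥ 1`): the exponential-moment bound with budget
`B_n(a) = Σ_k (4/(n-k) - 2/n)‖a_k‖²` for `n × n` arrays implies it for `(n+1) × (n+1)` arrays. Reveal `π(0) = p`:
`Z(π) - μ = d(p) + (Z'_p - μ'_p)` with `Z'_p` the permuted sum of the `n × n` sub-array `a'_p` (row `0` and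
column `p` deleted) and `d(p) = a(0,p) + μ'_p - μ` the first martingale difference: `Σ_p d(p) = 0`,
`|d(p)| ≤ 4m`, `Σ_p d(p)² ≤ 2‖a_0‖² + (2/n)Σ_{i ≥ 1}‖a_i‖²`, and
`(2‖a_0‖² + (2/n)Σ_{i≥1}‖a_i‖²)/(n+1) + B_n(a'_p) ≤ B_{n+1}(a)` (an identity of the coefficients up to the
dropped column). [folklore] -/
theorem mgf_perm_step (n : ℕ) (hn : 0 < n)
    (IH : (∀ (m : ℝ), 0 ≤ m → ∀ (a : Fin n → Fin n → ℝ), (∀ i j, |a i j| ≤ m) → ∀ (l : ℝ), 0 ≤ l → l * (4 * m) ≤ 1 →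
      ∑ π : Equiv.Perm (Fin n), Real.exp (l * (∑ i, a i (π i) - (∑ i, ∑ j, a i j) / (n : ℕ))) ≤
        ((n : ℕ).factorial : ℝ) * Real.exp (l ^ 2 * ∑ k : Fin n, (4 / (((n : ℕ) : ℝ) - k) - 2 / ((n : ℕ) : ℝ)) * ∑ j, a k j ^ 2))) :
    (∀ (m : ℝ), 0 ≤ m → ∀ (a : Fin (n + 1) → Fin (n + 1) → ℝ), (∀ i j, |a i j| ≤ m) → ∀ (l : ℝ), 0 ≤ l → l * (4 * m) ≤ 1 →
      ∑ π : Equiv.Perm (Fin (n + 1)), Real.exp (l * (∑ i, a i (π i) - (∑ i, ∑ j, a i j) / ((n + 1) : ℕ))) ≤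
        (((n + 1) : ℕ).factorial : ℝ) * Real.exp (l ^ 2 * ∑ k : Fin (n + 1), (4 / ((((n + 1) : ℕ) : ℝ) - k) - 2 / (((n + 1) : ℕ) : ℝ)) * ∑ j, a k j ^ 2)) := by
  intro m hm a ha l hl hlm
  have hnR : (0 : ℝ) < n := by exact_mod_cast hn
  have hn1 : (((n + 1 : ℕ) : ℕ) : ℝ) = (n : ℝ) + 1 := by push_cast; ring
  -- row sums, the sub-arrays, the first difference
  set R : Fin (n + 1) → ℝ := fun i => ∑ j, a i j with hR
  set a' : Fin (n + 1) → Fin n → Fin n → ℝ := fun p i j => a i.succ (Equiv.swap 0 p j.succ) with ha'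
  set μ : ℝ := (∑ i, ∑ j, a i j) / ((n + 1 : ℕ) : ℕ) with hμ
  set μ' : Fin (n + 1) → ℝ := fun p => (∑ i, ∑ j, a' p i j) / (n : ℕ) with hμ'
  set d : Fin (n + 1) → ℝ := fun p => a 0 p + μ' p - μ with hd
  -- (1) decomposition of the sum over permutations along `π(0) = p`
  have hdecomp : ∑ π : Equiv.Perm (Fin (n + 1)), Real.exp (l * (∑ i, a i (π i) - μ)) =
      ∑ p : Fin (n + 1), Real.exp (l * d p) *
        ∑ e : Equiv.Perm (Fin n), Real.exp (l * (∑ i, a' p i (e i) - μ' p)) := by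
    rw [← Equiv.sum_comp Equiv.Perm.decomposeFin.symm, Fintype.sum_prod_type]
    refine Finset.sum_congr rfl fun p _ => ?_
    rw [Finset.mul_sum]
    refine Finset.sum_congr rfl fun e _ => ?_
    rw [← Real.exp_add]
    congr 1
    rw [Fin.sum_univ_succ]
    simp only [Equiv.Perm.decomposeFin_symm_apply_zero, Equiv.Perm.decomposeFin_symm_apply_succ, ha', hd]
    ring
  -- (2) the induction hypothesis on each sub-array
  have hIH : ∀ p, ∑ e : Equiv.Perm (Fin n), Real.exp (l * (∑ i, a' p i (e i) - μ' p)) ≤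
      (n.factorial : ℝ) * Real.exp (l ^ 2 * ∑ k : Fin n, (4 / ((n : ℝ) - k) - 2 / (n : ℝ)) * ∑ j, a' p k j ^ 2) :=
    fun p => IH m hm (a' p) (fun i j => ha _ _) l hl hlm
  -- (3) the budgets of the sub-arrays are at most `B* = Σ_i (4/(n-i) - 2/n)‖a_{i+1}‖²`
  have hnorm : ∀ p (i : Fin n), ∑ j, a' p i j ^ 2 = ∑ j, a i.succ j ^ 2 - a i.succ p ^ 2 := fun p i =>
    sum_swap_succ p (fun j => a i.succ j ^ 2)
  have hcoef : ∀ k : Fin n, 0 ≤ 4 / ((n : ℝ) - k) - 2 / (n : ℝ) := by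
    intro k
    have hk : (k : ℝ) + 1 ≤ n := by exact_mod_cast k.isLt
    have h1 : 4 / (n : ℝ) ≤ 4 / ((n : ℝ) - k) :=
      div_le_div_of_nonneg_left (by norm_num) (by linarith) (by linarith [k.val.cast_nonneg (α := ℝ)])
    have h2 : 2 / (n : ℝ) ≤ 4 / (n : ℝ) := div_le_div_of_nonneg_right (by norm_num) hnR.le
    linarith
  have hBstar : ∀ p, ∑ k : Fin n, (4 / ((n : ℝ) - k) - 2 / (n : ℝ)) * ∑ j, a' p k j ^ 2 ≤
      ∑ k : Fin n, (4 / ((n : ℝ) - k) - 2 / (n : ℝ)) * ∑ j, a k.succ j ^ 2 := fun p =>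
    Finset.sum_le_sum fun k _ => mul_le_mul_of_nonneg_left
      (by rw [hnorm]; nlinarith [sq_nonneg (a k.succ p)]) (hcoef k)
  -- (4) the first difference in centred form
  set x : Fin (n + 1) → Fin (n + 1) → ℝ := fun i p => a i p - R i / ((n : ℝ) + 1) with hx
  have hμ'eq : ∀ p, μ' p = (∑ i : Fin n, (R i.succ - a i.succ p)) / n := by
    intro p
    simp only [hμ', ha']
    congr 1
    exact Finset.sum_congr rfl fun i _ => sum_swap_succ p (fun j => a i.succ j)
  have hμeq : μ = (R 0 + ∑ i : Fin n, R i.succ) / ((n : ℝ) + 1) := by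
    simp only [hμ, hR]
    rw [Fin.sum_univ_succ, hn1]
  have hdx : ∀ p, d p = x 0 p - (∑ i : Fin n, x i.succ p) / n := by
    intro p
    simp only [hd, hx, hμ'eq p, hμeq, Finset.sum_sub_distrib, ← Finset.sum_div]
    field_simp
    ring
  have hRbd : ∀ i, |R i| ≤ ((n : ℝ) + 1) * m := fun i => by
    calc |R i| ≤ ∑ j, |a i j| := Finset.abs_sum_le_sum_abs _ _
      _ ≤ ∑ j : Fin (n + 1), m := Finset.sum_le_sum fun j _ => ha i j
      _ = ((n : ℝ) + 1) * m := by simp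
  have hxbd : ∀ i p, |x i p| ≤ 2 * m := fun i p => by
    have h1 : |R i / ((n : ℝ) + 1)| ≤ m := by
      rw [abs_div, abs_of_pos (by linarith : (0 : ℝ) < n + 1), div_le_iff₀ (by linarith)]
      linarith [hRbd i]
    calc |x i p| = |a i p - R i / ((n : ℝ) + 1)| := rfl
      _ ≤ |a i p| + |R i / ((n : ℝ) + 1)| := abs_sub _ _
      _ ≤ 2 * m := by linarith [ha i p]
  have hxsum : ∀ i, ∑ p, x i p = 0 := fun i => by
    simp only [hx, Finset.sum_sub_distrib, Finset.sum_const, Finset.card_univ, Fintype.card_fin, nsmul_eq_mul]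
    rw [show (∑ p, a i p) = R i from rfl]
    push_cast
    field_simp
    ring
  have hxsq : ∀ i, ∑ p, x i p ^ 2 ≤ ∑ p, a i p ^ 2 := fun i => by
    have := sum_sq_sub_avg_le (a i)
    simp only [Fintype.card_fin] at this
    simp only [hx, hR]
    push_cast at this ⊢
    exact this
  have hdsum : ∑ p, d p = 0 := by
    calc ∑ p, d p = ∑ p, (x 0 p - (∑ i : Fin n, x i.succ p) / n) := Finset.sum_congr rfl fun p _ => hdx p
      _ = ∑ p, x 0 p - (∑ p, ∑ i : Fin n, x i.succ p) / n := by rw [Finset.sum_sub_distrib, Finset.sum_div]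
      _ = 0 := by
          rw [hxsum 0, Finset.sum_comm, Finset.sum_eq_zero (fun i _ => hxsum (Fin.succ i))]
          simp
  have hdbd : ∀ p, |d p| ≤ 4 * m := fun p => by
    rw [hdx]
    have h1 : |(∑ i : Fin n, x i.succ p) / n| ≤ 2 * m := by
      rw [abs_div, abs_of_pos hnR, div_le_iff₀ hnR]
      calc |∑ i : Fin n, x i.succ p| ≤ ∑ i : Fin n, |x i.succ p| := Finset.abs_sum_le_sum_abs _ _
        _ ≤ ∑ i : Fin n, 2 * m := Finset.sum_le_sum fun i _ => hxbd _ _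
        _ = 2 * m * n := by simp; ring
    calc |x 0 p - (∑ i : Fin n, x i.succ p) / n| ≤ |x 0 p| + |(∑ i : Fin n, x i.succ p) / n| := abs_sub _ _
      _ ≤ 4 * m := by linarith [hxbd 0 p]
  have hdvar : ∑ p, d p ^ 2 ≤ 2 * ∑ j, a 0 j ^ 2 + 2 / n * ∑ i : Fin n, ∑ j, a i.succ j ^ 2 := by
    have h1 : ∀ p, d p ^ 2 ≤ 2 * x 0 p ^ 2 + 2 * ((∑ i : Fin n, x i.succ p) / n) ^ 2 := fun p => by
      rw [hdx]; nlinarith [sq_nonneg (x 0 p + (∑ i : Fin n, x i.succ p) / n)]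
    have h2 : ∀ p, ((∑ i : Fin n, x i.succ p) / n) ^ 2 ≤ (∑ i : Fin n, x i.succ p ^ 2) / n := fun p => by
      rw [div_pow, div_le_div_iff₀ (by positivity) hnR]
      have := sq_sum_le_card_mul_sum_sq (s := (Finset.univ : Finset (Fin n))) (f := fun i => x i.succ p)
      rw [Finset.card_univ, Fintype.card_fin] at this
      nlinarith [this]
    calc ∑ p, d p ^ 2 ≤ ∑ p, (2 * x 0 p ^ 2 + 2 * ((∑ i : Fin n, x i.succ p ^ 2) / n)) :=
          Finset.sum_le_sum fun p _ => by linarith [h1 p, h2 p]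
      _ = 2 * ∑ p, x 0 p ^ 2 + 2 / n * ∑ i : Fin n, ∑ p, x i.succ p ^ 2 := by
          rw [Finset.sum_add_distrib, ← Finset.mul_sum, ← Finset.mul_sum, ← Finset.sum_div, Finset.sum_comm]
          ring
      _ ≤ 2 * ∑ j, a 0 j ^ 2 + 2 / n * ∑ i : Fin n, ∑ j, a i.succ j ^ 2 := by
          have hA := hxsq 0
          have hB : ∑ i : Fin n, ∑ p, x i.succ p ^ 2 ≤ ∑ i : Fin n, ∑ j, a i.succ j ^ 2 :=
            Finset.sum_le_sum fun i _ => hxsq i.succ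
          have h2n : (0 : ℝ) ≤ 2 / n := by positivity
          nlinarith [mul_le_mul_of_nonneg_left hB h2n]
  -- (5) the one-step bound for the first difference
  have hone : ∑ p, Real.exp (l * d p) ≤
      ((n : ℝ) + 1) * Real.exp (l ^ 2 * ((2 * ∑ j, a 0 j ^ 2 + 2 / n * ∑ i : Fin n, ∑ j, a i.succ j ^ 2) / ((n : ℝ) + 1))) := by
    have h := sum_exp_le_card_mul_exp d l hdsum (fun p => by
      rw [abs_mul, abs_of_nonneg hl]
      calc l * |d p| ≤ l * (4 * m) := mul_le_mul_of_nonneg_left (hdbd p) hl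
        _ ≤ 1 := hlm)
    rw [Fintype.card_fin] at h
    push_cast at h
    refine h.trans (mul_le_mul_of_nonneg_left (Real.exp_le_exp.mpr ?_) (by positivity))
    rw [mul_div_assoc]
    exact mul_le_mul_of_nonneg_left (div_le_div_of_nonneg_right hdvar (by positivity)) (sq_nonneg l)
  -- (6) the coefficient identity
  have hn0' : (n : ℝ) ≠ 0 := hnR.ne'
  have hident : (2 * ∑ j, a 0 j ^ 2 + 2 / n * ∑ i : Fin n, ∑ j, a i.succ j ^ 2) / ((n : ℝ) + 1) +
      ∑ k : Fin n, (4 / ((n : ℝ) - k) - 2 / (n : ℝ)) * ∑ j, a k.succ j ^ 2 =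
      ∑ k : Fin (n + 1), (4 / ((((n + 1 : ℕ) : ℕ) : ℝ) - k) - 2 / (((n + 1 : ℕ) : ℕ) : ℝ)) * ∑ j, a k j ^ 2 := by
    rw [hn1]
    rw [Fin.sum_univ_succ (f := fun k : Fin (n + 1) => (4 / (((n : ℝ) + 1) - k) - 2 / ((n : ℝ) + 1)) * ∑ j, a k j ^ 2)]
    simp only [Fin.val_zero, Nat.cast_zero, sub_zero, Fin.val_succ, Nat.cast_succ]
    have e1 : (2 * ∑ j, a 0 j ^ 2 + 2 / n * ∑ i : Fin n, ∑ j, a i.succ j ^ 2) / ((n : ℝ) + 1) +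
        ∑ k : Fin n, (4 / ((n : ℝ) - k) - 2 / (n : ℝ)) * ∑ j, a k.succ j ^ 2 =
        2 / ((n : ℝ) + 1) * ∑ j, a 0 j ^ 2 +
          ∑ k : Fin n, (2 / ((n : ℝ) * ((n : ℝ) + 1)) + (4 / ((n : ℝ) - k) - 2 / (n : ℝ))) * ∑ j, a k.succ j ^ 2 := by
      have : ∑ k : Fin n, (2 / ((n : ℝ) * ((n : ℝ) + 1)) + (4 / ((n : ℝ) - k) - 2 / (n : ℝ))) * ∑ j, a k.succ j ^ 2 =
          2 / ((n : ℝ) * ((n : ℝ) + 1)) * ∑ i : Fin n, ∑ j, a i.succ j ^ 2 +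
            ∑ k : Fin n, (4 / ((n : ℝ) - k) - 2 / (n : ℝ)) * ∑ j, a k.succ j ^ 2 := by
        rw [Finset.mul_sum, ← Finset.sum_add_distrib]
        exact Finset.sum_congr rfl fun k _ => by ring
      rw [this]
      field_simp
      ring
    rw [e1]
    have e2 : (4 / ((n : ℝ) + 1) - 2 / ((n : ℝ) + 1)) * ∑ j, a 0 j ^ 2 = 2 / ((n : ℝ) + 1) * ∑ j, a 0 j ^ 2 := by ring
    rw [e2]
    congr 1
    refine Finset.sum_congr rfl fun i _ => ?_
    have hi : (i : ℝ) + 1 ≤ n := by exact_mod_cast i.isLt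
    have h3 : (n : ℝ) - i ≠ 0 := by linarith
    have h4 : (n : ℝ) + 1 - ((i : ℝ) + 1) = (n : ℝ) - i := by ring
    rw [h4]
    congr 1
    field_simp
    ring
  -- (7) assemble
  have hfac : (((n + 1 : ℕ) : ℕ).factorial : ℝ) = ((n : ℝ) + 1) * n.factorial := by
    push_cast [Nat.factorial_succ]; ring
  calc ∑ π : Equiv.Perm (Fin (n + 1)), Real.exp (l * (∑ i, a i (π i) - μ))
      = ∑ p : Fin (n + 1), Real.exp (l * d p) * ∑ e : Equiv.Perm (Fin n), Real.exp (l * (∑ i, a' p i (e i) - μ' p)) :=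
        hdecomp
    _ ≤ ∑ p : Fin (n + 1), Real.exp (l * d p) * ((n.factorial : ℝ) *
          Real.exp (l ^ 2 * ∑ k : Fin n, (4 / ((n : ℝ) - k) - 2 / (n : ℝ)) * ∑ j, a k.succ j ^ 2)) := by
        refine Finset.sum_le_sum fun p _ => mul_le_mul_of_nonneg_left ((hIH p).trans ?_) (Real.exp_pos _).le
        exact mul_le_mul_of_nonneg_left (Real.exp_le_exp.mpr (mul_le_mul_of_nonneg_left (hBstar p) (sq_nonneg l)))
          (Nat.cast_nonneg _)
    _ = (∑ p : Fin (n + 1), Real.exp (l * d p)) * ((n.factorial : ℝ) *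
          Real.exp (l ^ 2 * ∑ k : Fin n, (4 / ((n : ℝ) - k) - 2 / (n : ℝ)) * ∑ j, a k.succ j ^ 2)) := by
        rw [Finset.sum_mul]
    _ ≤ ((n : ℝ) + 1) * Real.exp (l ^ 2 * ((2 * ∑ j, a 0 j ^ 2 + 2 / n * ∑ i : Fin n, ∑ j, a i.succ j ^ 2) / ((n : ℝ) + 1))) *
          ((n.factorial : ℝ) * Real.exp (l ^ 2 * ∑ k : Fin n, (4 / ((n : ℝ) - k) - 2 / (n : ℝ)) * ∑ j, a k.succ j ^ 2)) :=
        mul_le_mul_of_nonneg_right hone (by positivity)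
    _ = (((n + 1 : ℕ) : ℕ).factorial : ℝ) * Real.exp (l ^ 2 * ((2 * ∑ j, a 0 j ^ 2 + 2 / n * ∑ i : Fin n, ∑ j, a i.succ j ^ 2) / ((n : ℝ) + 1) +
          ∑ k : Fin n, (4 / ((n : ℝ) - k) - 2 / (n : ℝ)) * ∑ j, a k.succ j ^ 2)) := by
        rw [hfac]
        conv_rhs => rw [mul_add, Real.exp_add]
        ring
    _ = _ := by rw [hident]

/-- Base case `n = 0` of the exponential-moment bound (both sides equal `1`). [folklore] -/
theorem mgf_perm_zero : (∀ (m : ℝ), 0 ≤ m → ∀ (a : Fin 0 → Fin 0 → ℝ), (∀ i j, |a i j| ≤ m) → ∀ (l : ℝ), 0 ≤ l → l * (4 * m) ≤ 1 →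
      ∑ π : Equiv.Perm (Fin 0), Real.exp (l * (∑ i, a i (π i) - (∑ i, ∑ j, a i j) / (0 : ℕ))) ≤
        ((0 : ℕ).factorial : ℝ) * Real.exp (l ^ 2 * ∑ k : Fin 0, (4 / (((0 : ℕ) : ℝ) - k) - 2 / ((0 : ℕ) : ℝ)) * ∑ j, a k j ^ 2)) := by
  intro m hm a ha l hl hlm
  simp

/-- Base case `n = 1` of the exponential-moment bound (`Z = μ`). [folklore] -/
theorem mgf_perm_one : (∀ (m : ℝ), 0 ≤ m → ∀ (a : Fin 1 → Fin 1 → ℝ), (∀ i j, |a i j| ≤ m) → ∀ (l : ℝ), 0 ≤ l → l * (4 * m) ≤ 1 →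
      ∑ π : Equiv.Perm (Fin 1), Real.exp (l * (∑ i, a i (π i) - (∑ i, ∑ j, a i j) / (1 : ℕ))) ≤
        ((1 : ℕ).factorial : ℝ) * Real.exp (l ^ 2 * ∑ k : Fin 1, (4 / (((1 : ℕ) : ℝ) - k) - 2 / ((1 : ℕ) : ℝ)) * ∑ j, a k j ^ 2)) := by
  intro m hm a ha l hl hlm
  have h1 : ∑ π : Equiv.Perm (Fin 1), Real.exp (l * (∑ i, a i (π i) - (∑ i, ∑ j, a i j) / (1 : ℕ))) = 1 := by
    rw [Fintype.sum_unique]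
    simp [Subsingleton.elim (default : Equiv.Perm (Fin 1)) 1]
  rw [h1]
  have h2 : (0 : ℝ) ≤ l ^ 2 * ∑ k : Fin 1, (4 / (((1 : ℕ) : ℝ) - k) - 2 / ((1 : ℕ) : ℝ)) * ∑ j, a k j ^ 2 := by
    rw [Fin.sum_univ_one]
    simp only [Nat.cast_one, Fin.val_zero, Nat.cast_zero, sub_zero]
    have : (0 : ℝ) ≤ ∑ j : Fin 1, a 0 j ^ 2 := Finset.sum_nonneg fun _ _ => sq_nonneg _
    positivity
  calc (1 : ℝ) = 1 * Real.exp 0 := by simp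
    _ ≤ ((1 : ℕ).factorial : ℝ) * Real.exp (l ^ 2 * ∑ k : Fin 1, (4 / (((1 : ℕ) : ℝ) - k) - 2 / ((1 : ℕ) : ℝ)) * ∑ j, a k j ^ 2) := by
        rw [Nat.factorial_one, Nat.cast_one]
        simp only [Nat.cast_one] at h2
        exact mul_le_mul_of_nonneg_left (Real.exp_le_exp.mpr h2) zero_le_one

/-- **Exponential-moment bound for permuted sums, order-dependent budget**: for every `n`, every array
`a : Fin n → Fin n → ℝ` with `|a i j| ≤ m` and `0 ≤ λ ≤ 1/(4m)`,
`Σ_π exp(λ(Σ_i a i (π i) - μ)) ≤ n!·exp(λ²·Σ_k (4/(n-k) - 2/n)·Σ_j a k j²)`. [folklore] -/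
theorem mgf_perm_le : ∀ n : ℕ, (∀ (m : ℝ), 0 ≤ m → ∀ (a : Fin n → Fin n → ℝ), (∀ i j, |a i j| ≤ m) → ∀ (l : ℝ), 0 ≤ l → l * (4 * m) ≤ 1 →
      ∑ π : Equiv.Perm (Fin n), Real.exp (l * (∑ i, a i (π i) - (∑ i, ∑ j, a i j) / (n : ℕ))) ≤
        ((n : ℕ).factorial : ℝ) * Real.exp (l ^ 2 * ∑ k : Fin n, (4 / (((n : ℕ) : ℝ) - k) - 2 / ((n : ℕ) : ℝ)) * ∑ j, a k j ^ 2))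
  | 0 => mgf_perm_zero
  | 1 => mgf_perm_one
  | (n + 2) => mgf_perm_step (n + 1) (Nat.succ_pos n) (mgf_perm_le (n + 1))

end Summit.MatrixMultiplication.MatrixMultiplication.Theorems.PolynomialSlack
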